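import Literature.MathematicalPhysics.QuantumFieldTheory.Balaban1983to89.B12Eq213Body268
import Literature.MathematicalPhysics.QuantumFieldTheory.Balaban1983to89.B12EuclClause263
import Literature.MathematicalPhysics.QuantumFieldTheory.Balaban1983to89.StepInhabited

/-!
# `Balaban1983to89.B12Carve20Sect2FluctuationHyp` — [B12] Sect. 2, pp. 265–269 («Fluctuation Field Integral in k+1
# Renormalization Transformation», displays (2.1)–(2.18)) CARVED: the section's printed statements conjoined BY NAME into
# one hypothesis bundle `Hyp` for ONE step `k → k+1`, keyed to `stmt-QuantumFields-20543` (also feeds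
# `stmt-QuantumFields-20541`); the five printed sentences of pp. 265, 268, 269 that no declaration of the tree states AS A
# STATEMENT typed hypothesis-form; the in-tree citation index of the block's sixteen SKELETON rows; and kernel-checked
# bookkeeping over the bundle (the step extends the inductively generated sequence by one, the form (1.3) advances, the
# gauge ∕ Euclidean clauses advance) — nothing printed is proved here

statement-level skeleton of published theorems with citation tags; proofs where landed; nothing here is a claim about the
Yang–Mills mass gap

CITATION HEADER (lean-in-tree rule).  B12 = [I] = T. Bałaban, *Renormalization group approach to lattice gauge field
theories. I. Generation of effective actions in a small field approximation and a coupling constant renormalization in four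
dimensions*, Commun. Math. Phys. **109** (1987) 249–301 [Balaban1987RG1] (doi:10.1007/bf01215223; held
`paper:balaban1987-cmp109-rg-i-small-field`, journal page = PDF page + 248; text layer `pNNNN.txt` of `lit read`, cited below as
`p00NN.txt:Lnn`; the page renders `pub/pub-balaban/b2b-balaban-ref1/pages/1987-cmp109-rg-I-small-field/…-p017-x2.png …
-p021-x2.png` of pp. 265–269 were READ AS IMAGES by this seat, 2026-08-28 — every display quoted below was checked on them, the
text layer being garbled in the formulas).  References of the section: [12] = [Balaban1985Averaging] (CMP **98**), [13] =
[Balaban1985BackgroundPropagators] (CMP **99**), [14] = [Balaban1985RegularSpaces] (CMP **99**, 75–102), [15] =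
[Balaban1985Variational] (CMP **102**).  Cell `lit-balaban`, P6 CARVING FAN (D-0154 (3b)), BLOCK 20 of `carve/BLOCKS-11-20.md`
(lead g30, 2026-08-28T05:30Z): source section = [B12] Sect. 2, journal pp. 265–269 [PDF 17–21], displays (2.1)–(2.18); KEY item
`stmt-QuantumFields-20543` (K2⁷ `EndpointGivenBR13SepCoPH`); also feeds `stmt-QuantumFields-20541`.  Seat `lit-balaban-carve-20`
(literature-prover-lit-balaban-carve-20-g0-0).  Rules `carve/CARVE-RULES.md`: in tree = cite, never restate; hypothesis form; no
`instance`, no `notation`; 0 sorry; desk stems untouched (none of the decade-2 off-limits stems — `Node00/…`, `T3*`, `T4*`,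
`B11Thm1*`, `B11Leaf*`, and the decade-1 list — is written into; they are cited where relevant).

WHAT THIS FILE IS.  Sect. 2 of [I] prints NO numbered theorem: it is the COMPUTATION of one renormalization step — (2.1) the
transformation `𝐓_k` restricted by `χ_k`, (2.2)–(2.3) the saddle point `V⁽ᵏ⁾`, (2.4)–(2.11) the change of variables,
linearization and scaling, (2.12) the resulting expression for `A_{k+1}`, (2.13)–(2.15) the definition of the new term `𝐄^{(k+1)}`,
of `𝐍″_k` and of `g_{k+1}` — followed by the invariance discussion (2.16)–(2.18) and the REDUCTION of Theorem 3 to the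
properties of (2.13) (p. 269).  The block is IN TREE at statement level (16 SKELETON rows of v3.368: proved 10, proved-existing 4,
typed 1, typed-existing 1; 1494 declarations in 203 files carry a locator in pp. 265–269).  Accordingly this file (i) RESTATES
NOTHING that has a declaration: every row is cited by name in the INDEX below, and the rows' HYPOTHESIS-FORM declarations are
USED, by name, in the bundle — `Setup.SmallFieldStepOp` ((2.1)/(0.19), operator level), `B12SmallFieldDomain259.CriticalPoint23` ((2.2)–(2.3)), the
BODY `B12Eq213Body268.action212` of the right member of (2.12) with the datum `B12Eq213Body268.FluctData` of (2.13) (`newTerm`,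
`normConst`, (2.14) `log_normConst` by `rfl`), the tower `Step.SFTower` of (1.3) whose new bracket (2.13)–(2.15) fill, and the
symmetry predicates `GaugeField.GaugeInvariant` ∕ `B12EuclClause263.NestedInvariant` of (2.16) ∕ (2.17); rows realised by PROVED
theorems or by definitions with bodies are cited only (a proved statement is not a hypothesis); (ii) types, hypothesis-form over
these carriers and in the exact binder shapes the tree's bookkeeping theorems already consume, the FIVE printed sentences of the
section that no declaration states as a statement: `ChiSupportPrinted` (p. 265, the support proviso of `χ_k` — in tree only the
binder `hχ` of `B12Eq019ActionBody.nextAction_eq_action21`), `Eq212Printed` (p. 268 «After these transformations we obtain the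
following expression for the new action» = the EQUATION (2.12) for the `(0.19)`-constructed `A_{k+1}` — in tree only its right
member WITH BODY, `action212`, and the binder `h212` of `B12Eq213Body268.form13_succ_of_action212_background`; SKELETON row
B12.Eq2.13 records «the EQUATION (2.12) for the (0.19)-constructed A_{k+1} — the computation (2.2)–(2.11) — is NOT transported»),
`Def213Printed` (p. 268 «The integral in (2.12) defines the new term 𝐄^{(k+1)} in the inductive definition of the action A_{k+1}
by the formula (2.13)» — the binders `hdef`/`hdef1` ibid.), `GaugeNewPrinted` (p. 269, (2.16): the bracket `log Z^{(k)}` and the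
term (2.13) are gauge invariant functions of the background field — the binder `hZ` of `B12GaugeOrbits021.action13_gaugeAct` at
`j = k` and the real form of (1.19) at `j = k+1`), `EuclNewPrinted` (p. 269, (2.17)–(2.18): the same two expressions are
invariant under the Euclidean transformations preserving `T^{(k+1)}` — the `j = k` component of the p. 263 clause
`B12EuclClause263.EuclClause263 T (k+1)`, cf. `euclClause263_succ_iff` below); (iii) defines ONE bundle `Hyp` = the
conjunction, by name, of the section's printed statements at the step `k`; (iv) kernel-checks (§4) how the bundle delivers the
section's three printed CONSEQUENCES through the tree's own theorems: p. 268 «the action A_{k+1} is given by (1.3) with k+1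
instead of k» (`Hyp.form13_succ`, by `B12Eq213Body268.form13_succ_of_action212_background`), whence the inductively generated
sequence `Step.GeneratedBySmallFieldRT` EXTENDS BY ONE STEP (`Hyp.generated_succ` — the §2 step is one more step of the object
Theorem 3 p. 264 speaks about), p. 269 «therefore the expression (2.13) is gauge invariant» ⇒ `A_{k+1}` gauge invariant
(`Hyp.gaugeInvariant_action13_succ`), p. 269 «Thus the effective action is invariant with respect to the Euclidean transformations
(2.17) of the background field» (`Hyp.nestedInvariant_action13_succ`, by `B12EuclClause263.action13_nestedInvariant`), and (2.1)
read with «𝐄_k … is equal to (1/g_k²)A + A_k» on the support of `χ_k` (`Hyp.nextAction_eq_action21`, by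
`B12Eq21Body265.nextAction_eq_action21_of_form13`).  It moves no node count and proves no summit statement.

DICTIONARY USED THROUGHOUT (the cell's `Setup` ∕ `Step` vocabulary; ours, said once).  `bg : Background P G av` is the
background-field assignment `V ↦ U_j(V)` of (0.21)/(1.1) ([15] Thm 1) with its domains: **`bg.dom j` = the class of configurations
print quantifies over on p. 265** — for `j = k+1` «regular configurations W defined on T^{(k+1)} … so regular that the minimal
configurations U_{k+1}(W) exist and belong to the space U_{k+1}(ε₀)», for `j = k` the «configurations V for which U_k(V) ∈
U_k(ε₀)» (its concrete p. 259 refinement by the plaquette condition is `B12SmallFieldDomain259.smallFieldDom bg ε₀ j ⊆ bg.dom j`,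
the space `U_k(ε₀)` of (1.2) itself is `Setup.RegularSpace`); `Tk j : RTOp P j G (av j)` = the transformation `𝐓_j` of (0.19)/(2.1)
(push-forward reading F7); `χ j`, `GF j : Density P j G` = the characteristic function `χ_j` (as a function of `V`) and the
gauge-fixing function `𝐆` of (0.17)/(2.1); `A j : Density P j G` = the action `A_j` as a function of `V ∈ T^{(j)}`-configurations;
`T : Step.SFTower P G Φ 𝒢` = the data of the form (1.3) (couplings `g_j = T.flow.g j`, β-functions, `log Z^{(j)} = T.logZ j`, the
terms `𝐄^{(j)}(X, g_{j−1}, ·)` with `T.Etot j g (T.ofBackground U) = 𝐄^{(j)}(g, U)` at a real background field `U`,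
`Step.SFTower.action13 T j` = (1.3)); `cd : ContourData P k G`, `reg` = the contour variables of the gauge-fixing function
`𝐆(V) = Σ_y Σ_{x∈B(y),x≠y}[1 − Re tr V(y,x)]` (`Setup.gaugeFixFn cd Finset.univ` — the `𝐆` of (2.2), `= GF k` in the intended
instance) and the regular class of (2.2)'s minimisation, exactly the parameters of `B12SmallFieldDomain259.CriticalPoint23`;
`D : B12Eq213Body268.FluctData (GaugeField P 0 G)` = the fluctuation datum of step `k` (the remaining variables `B`, the Gaussian
measures `dμ_{C^{(k)}(U_{k+1})}`, `χ_k` of (2.9) as a function of `B′`, the exponent parts `𝐏^{(k)}` and `{…}`; print's `χ_k` on its own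
carrier is `FluctData.onBondsPrinted … (B12SmallFieldDomain259.chiFluctPrinted ε₁) …`).  `A` = the `d = 4` Wilson action
`wilsonAction4` (print's `A`, `A^η`; DIVERGENCE F10 of the cell).

INDEX — the sixteen SKELETON rows of block 20 — row id · printed item · page: journal [PDF] (text-layer lines) · IN-TREE
declarations cited BY NAME (all under `Literature.MathematicalPhysics.QuantumFieldTheory.Balaban1983to89.`; «used» = a carrier or
conjunct of `Hyp` below; «proved» ∕ «def» = a theorem ∕ a definition with body in the tree, hence not a hypothesis here):
* B12.Eq2.1 · (2.1) `(𝐓_kA_k)(W) = log 𝐍_k⁻¹ ∫dV δ(V̄W⁻¹) χ_k exp[−(1/g_k²)𝐆(V) − (1/g_k²)A(U_k(V)) + 𝐄_k(U_k(V))]`, «The meaning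
  of the function 𝐄_k is obvious, it is equal to (1/g_k²)A + A_k», «By Proposition 2 from the paper [12] this implies that
  |W(∂p′) − 1| < 2ε₀» · p. 265 [17] (`p0017.txt:L3–L17`) · `Setup.SmallFieldStepOp` (used, conjunct (1)), `SmallFieldStep`,
  `SmallFieldStepI`, `Step.GeneratedBySmallFieldRT` (field `step`) and its operator-level ∕ `RTOpI` forms
  `Step.GeneratedBySmallFieldOp` ∕ `Step.GeneratedBySmallFieldRTI` (module `StepInhabited`; used in §4); with body:
  `B12Eq019ActionBody.nextAction` ∕ `action21`, `B12Eq21Body265.EkOf` ∕ `action21_EkOf` ∕ `nextAction_eq_action21_of_form13`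
  (proved; delivered by `Hyp.nextAction_eq_action21`), `B12Eq21Body265.printedStep21` (print's own `𝐓_k` and `𝐆`,
  `B12RT013TwoLevel`); the Prop. 2 [12] claim `B12Prop2Claims260.Claim265Printed` with `Claim265Printed_holds` (PROVED; for [I]'s
  own average `B12Average012Prop2.claim265_012`); the gauge-covariance sentence «the δ-functions in (2.1) are invariant»:
  `B12RTGaugeInvariance254.isRT_comp_gaugeAct` ∕ `smallFieldStep_gaugeInvariant_ae`, `B12Average012Covariance` (proved); the
  support proviso «We will define the characteristic function χ_k in such a way that …» had no declaration — `ChiSupportPrinted`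
  (§1, conjunct (2)).
* B12.Eq2.2-2.3 · (2.2) `V → 𝐆(V) + A(U_k(V)), V : V̄ = W`, «there exists the exactly one critical point … a minimum», (2.3)
  `V⁽ᵏ⁾ = Ū^k_{k+1} = M^k(U_{k+1})` · p. 265 [17] (`p0017.txt:L18–L27`) · `B12SmallFieldDomain259.CriticalPoint23` (used, conjunct
  (3); statement only, the proof is [15] Sect. G), `B10NestedMinimizer.*` (the abstract nested-minimiser algebra, d = 3 twin),
  `B12CriticalPoint23`, `B12GaugeOrbits021.exprs21_invariant` (p. 265 «The expressions in (2.1) are invariant with respect to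
  these transformations», «This does not change the expressions in (2.1)», proved), `B12GaugeFixExpansion25.gaugeFixFn_eq_zero_iff_axialGauge`
  («the axial gauge conditions 𝐆(V) = 0»); the Sect. G [15] sentences of pp. 265–266 (`U_k(V′V⁽ᵏ⁾) = U′_k(V′)U_{k+1}`, `u_k`,
  `U′ᵘᵏ⁻¹_k = exp iη𝐇_k(B′)`, «u_k is an analytic function of 𝐇_k, hence of B′ … |𝐇_k| < a₁») are [15]'s (174), (106) [12] —
  block 16 ([B11] Sect. G): `B11AxialTransport190`, `B11Eq174Chart`, `B11Claim309UAnalytic`, `B12ActionExpansion26` (cited only).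
* B12.Eq2.4 · (2.4) `M(V′V⁽ᵏ⁾)M(V⁽ᵏ⁾)⁻¹ = exp iQ̃(B′)` · p. 266 [18] (`p0018.txt:L4–L6`) · `B12AverageCorridor267.Qtilde` (def),
  `curve_eq`, `hasDerivAt_Qtilde_single`, `pert`; covariance `B12Average012Covariance.rotB`, `B12Average012QtildeCovariance.*`,
  analyticity `B12Average012Analytic.*` (proved ∕ defs).
* B12.Eq2.5 · (2.5) `𝐆(B′) = Σ_{y∈T^{(k+1)}} Σ_{x∈B(y),x≠y} ½|B̃′(y,x)|² + G₃(B′) = ½G⁽²⁾(B′) + G₃(B′)`, «G₃(B′) is an analytic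
  function of B′, with an expansion beginning with third order terms, localized in blocks» · p. 266 [18] (`p0018.txt:L7–L13`) ·
  `B12GaugeFixExpansion25.eq25_expansion` (PROVED: `eq25`, `G3_analyticAt`, `G3_isBigO`, `G3block_local`), `tildeV`, `Btilde`, `G2`,
  `G3`; `B12GaugeFixExpansion25Holo.*`; `B12Eq210Scaling.Gfix`.
* B12.Eq2.6-2.8 · (2.6)–(2.8), «By Eq. (171) [15] we have ⟨𝐀₁, J⟩ = 0», `D = D⁽²⁾ + D₃`, `D⁽²⁾ = C⁽²⁾`, (2.7) · p. 266 [18]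
  (`p0018.txt:L14–L30`) · `B12ActionExpansion26.eq26` ((2.6), proved from the named inputs), `B12ActionExpansion26.V28`,
  `B12ActionExpansion26Lattice.*` ((2.6)–(2.8) on the lattice carriers), `B12Interfaces.eq27_of_lagrange`,
  `quadForm_add_of_orthogonal` ((2.7), proved), `B11Eq171Criticality` ((171) [15]), `B13ExpansionOrder.*` (the order statements
  made quantitative).
* B12.Eq2.9 · (2.9) `χ_k = Π_{b∈T⁽ᵏ⁾∖{b₀(c): c∈T⁽ᵏ⁺¹⁾}} χ({|B′(b)| < ε₁})`, the alternative `(g_k/γ_k)ε₁`, `γ_k = C log(L^kε)⁻¹`,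
  «the functions 𝐄⁽ʲ⁾, β_j are analytic functions of the effective coupling constants», «restrictions on B′(b₀(c)), with the
  constant ε₁ replaced by O(ε₁)» · pp. 266–267 [18–19] (`p0018.txt:L31–L37`, `p0019.txt:L2–L4`) ·
  `B12SmallFieldDomain259.chiFluctPrinted` ((2.9) AS PRINTED, def), `chiFluct`, `chiFluctAlt`, `chiFluctPrintedAlt`, `gammaK`,
  `gammaK_eq`, `b0`, `corridor` (defs ∕ proved); `B12Eq213Body268.FluctData.onBondsPrinted` (the datum with print's `χ_k`); the
  analyticity alternative `B12CouplingClausesHistory.AnalyticInCouplings266` ∕ `AnalyticInEachCoupling266` ∕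
  `BetaAnalyticInCouplings266`, `B12BetaSmooth.EAnalyticAt` ∕ `BetaAnalyticAt` (hypothesis-form defs for the ALTERNATIVE choice —
  cited, not conjoined: print formulates «both possibilities»); the O(ε₁) rider PROVED at the linear level
  `B12B0Restriction267.norm_b0_le_of_chiFluctPrinted`, `chiFluct_eq_one_of_chiFluctPrinted`, with `B12B0RestrictionNonlinear267`,
  `B12B0RestrictionMainTerm`, `B12B0RestrictionAverage267`, `B12LQLocalityBound267`.
* B12.Eq2.10 · (2.10) the transformed integral · p. 267 [19] (`p0019.txt:L5–L11`) · `B12Eq210Scaling.Setting.bracket210` (the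
  bracket WITH BODY), `Setting`, `bracket210_eq`, `oldVar`, `constraint_oldVar`, `terms211` (typed ∕ proved).
* B12.Def@267 · the operator `h` («hB = 0 except on {b₀(c)}», «LQ̃h = I», «(hB)(b₀(c)) = h(c)B(c)», unique), the linearizing
  change `B′ = B − hD̃(B)`, «there exists exactly one solution … analytic … expansion beginning with quadratic terms, and
  D̃⁽²⁾(B) = C̃⁽²⁾(B)» · p. 267 [19] (`p0019.txt:L16–L33`) · THEOREMS OF RECORD `B12Lineariz267.exists_Dt`, `Dt_unique`,
  `B12HOperator267.corridorSupported_hOp`, `hOpₗ`, `IsQppLocal`, `CorridorSupported`, `B12HOperatorNeumann267`,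
  `B12SecondOrder267Concrete.p267_second_order_concrete`, `B12LinearizAnalytic267`, `B12LinearizationGenuineZd`,
  `B13QuadAnalyticFrechet`, `B13PkLocalTerms.hOp` (proved ∕ defs).
* B12.Eq2.11 · scaling `B = g_kB′`, «the third, linear term in (2.10) vanishes … because ⟨δA′, J⟩ = 0», (2.11), «The quadratic
  form in B′ above is equal to −1/2⟨B′, Δ⁽ᵏ⁾B′⟩, see the definition (3.156) [13]», «defines the k-th normalization factor
  Z⁽ᵏ⁾(U_{k+1}) given by the formula (1.4)», «we eliminate the variables B′(b₀(c)) … B′ = CB», «covariance C⁽ᵏ⁾ = (C*Δ⁽ᵏ⁾C)⁻¹» ·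
  pp. 267–268 [19–20] (`p0019.txt:L33–L44`, `p0020.txt:L2–L5`) · `Beta.ConstraintElimination.elim` (+ `constraint_mulVec_elim`,
  `elim_unique`; PROVED), `B12Eq211Operator267.gMat`, `B12Eq15QuadraticForm.*` ((2.11) = −½⟨B′,Δ⁽ᵏ⁾B′⟩, Z⁽ᵏ⁾ via (1.4)),
  `B9SectECov.eq_3157` ∕ `cov_eq_of_genFun` ∕ `eq_3158_elim` ((3.156)–(3.158) [13]), `B12Eq213Body268.prec212` ∕ `prec212U` ∕
  `FluctData.gaussian` ∕ `covariance_gaussian_prec212U` (the measure clause WITH BODY), `B12Eq216GaussianCarrier.*`,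
  `B12Def267Covariance.*`, `B12Eq216MeasureCovariance.*`, `Beta.OneLoop.logZ`.
* B12.Eq2.12 · (2.12) «After these transformations we obtain the following expression for the new action» · p. 268 [20]
  (`p0020.txt:L6–L15`) · right member WITH BODY `B12Eq213Body268.action212` (used), `action212_eq`, `action212_one`,
  `exp_action212`; the Jacobian `Tr log(I − h(δ/δB)D̃)`: `B12JacobianTrLog268.*`, `B12TrLogReal268.*`, `B12TrLogBranch268.*`,
  `B12JacobianReal267`, `B13HaarSigmaJacobian`; the order structure of the five `1/g_k²`-terms `B13PkScaling`, `B13ExpansionOrder`,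
  `B13PkOrderEdges`; the OBLIGATION forms `Step.SFStepObligation`, `Step.SFStepObligationS` ∕ `…Op` ∕ `…I` of module `StepInhabited` (= Thm 3 per step,
  `Step.B12Thm3Shape_iff_obligation`; cited, NOT conjoined — it is the theorem under proof, not a statement of §2); the
  EQUATION itself had no declaration — `Eq212Printed` (§1, conjunct (4)).
* B12.Eq2.13 (coarse row «§2 (2.12)–(2.15): the reduction of Thm 3») · (2.13) `𝐄^{(k+1)}(g_k, U_{k+1}) = log ∫dμ_{C⁽ᵏ⁾}(B) χ_k
  exp[𝐏⁽ᵏ⁾(g_k, U_{k+1}, B) + {…}]`, «𝐍″_k is equal to the integral above at U_{k+1} = 1» · p. 268 [20] (`p0020.txt:L16–L22`) ·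
  WITH BODY `B12Eq213Body268.FluctData.newTerm`, `integral`, `normConst`, `exponent`, `toFluct` (= `B16EflSup.FluctuationIntegral`),
  `B12Form13Step268.action13_succ` ∕ `form13_succ_of_eq212`, `B12Eq213Body268.form13_succ_of_action212(_background)` (PROVED; used
  in §4); the definitional sentence «The integral in (2.12) defines the new term» as the identification of the tower's term had
  no declaration — `Def213Printed` (§1, conjunct (5)).
* B12.Eq2.14 · «the expression under the exponential above vanishes at g_k = 0», (2.14) `log 𝐍″_k = 𝐄^{(k+1)}(g_k, 1)` · p. 268
  [20] (`p0020.txt:L23–L25`) · `B12Eq213Body268.FluctData.log_normConst` ((2.14), `rfl` on the body), `newTerm_of_exponent_zero`;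
  `B12ZeroCoupling268.p268_vanishes_at_zero_coupling` (PROVED, schematic letters), `B12Beta.OneLoopSplit`,
  `BetaPertRigid.RemainderVanishes`; the remark over the datum is conjunct (6) (inline).
* B12.Eq2.15 · (2.15) `1/g_k² = 1/g_{k+1}² + β_{k+1}(g_k)`, «The equalities (2.12), (2.14) together with the definitions (2.13),
  (2.15) imply that the action A_{k+1} is given by (1.3) with k+1 instead of k» · p. 268 [20] (`p0020.txt:L26–L31`) ·
  `Setup.Flow.SatisfiesRG` = `Step.RGEq` (`B12Sec2to5.eq215_is_rgEq`), `Step.SFNewTerm.rg`, `B12StepObligation.rg_of_satisfiesRG`,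
  `B12Normalization.beta_eq_of_dict`; `B12Form13Step268.action13_succ` (PROVED); conjunct (7) is the equation (2.15) itself.
* B12.Eq2.16 · (2.16) `U_{k+1} → Uᵘ_{k+1}, B′ → R(u)B′, (R(u)B′)(b) = R(u(b₋))B′(b)`, «all the expressions in (2.12), together
  with the measure, are invariant», «The characteristic function is invariant … local, orthogonal transformations; therefore the
  expression (2.13) is gauge invariant» · p. 269 [21] (`p0021.txt:L2–L9`) · `B12Inv329.Recipe.Inv329At`, `SlotInvAt` (the abstract
  (3.29)-recipe), the MECHANISM proved on the datum `B12Eq213Body268.FluctData.integral_eq_of_covariant` ∕ `newTerm_eq_of_covariant`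
  ∕ `action212_eq_of_covariant` ∕ `newTerm_gaussian_elim_eq_of_covariant` ∕ `newTerm_onBondsPrinted_eq_of_covariant`,
  `B12ChiInvariance269.chiFluctPrinted_rotFluct` ∕ `chiFluct_comp_local_isometry` (the `χ_k` clause PROVED), `B12Eq25GaugeInvariance216.*`,
  `B12JacobianGauge269.*` ∕ `B12JacobianGauge269Torus.*`, `B12GaugeFixInvariance269.*`, `B12Eq216MeasureCovariance.*`,
  `B12GaugeOrbits021.gaugeInvariant_action13` (p. 263); the CONCLUSION for the new bracket of (1.3) had no declaration —
  `GaugeNewPrinted` (§1, conjunct (8)).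
* B12.Eq2.17-2.18 · (2.17) `(rU)(b) = U(rb)`, (2.18), «r(V′V⁽ᵏ⁾) = (rV′)(rV⁽ᵏ⁾)», «generates an orthogonal transformation of the
  fluctuation field B′», «Thus the effective action is invariant with respect to the Euclidean transformations (2.17) of the
  background field» · p. 269 [21] (`p0021.txt:L9–L23`) · THEOREMS OF RECORD `B12EuclTransf218.reflect_prodCfg`, `lin218_orthogonal`,
  `B12Average012Permutation.avgBar_permE`; `B12EuclTransf218.prodCfg` ∕ `reflectPrime` ∕ `lin218`, `B12ChiInvariance269.clin218` ∕
  `chiFluctPrinted_clin218` ∕ `chiFluctPrinted_translate` ∕ `chiFluctPrinted_cbond`, `B12EuclClause263.NestedInvariant` (used) ∕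
  `EuclClause263` ∕ `action13_nestedInvariant` ∕ `BackgroundCovariant` ∕ `action_comp_background_invariant` ∕ `chiFluctPrinted_permute`,
  `B12SmallFieldDomain259.EuclInvariant`, `TorusHypercubicSymmetry.GaugeField.permute/reflect`, `T4Covariance.GaugeField.creflect`,
  `B12Def267Permutation.*`; the CONCLUSION at the new index had no declaration — `EuclNewPrinted` (§1, conjunct (9)).
* B12.Txt@269 · «Thus the proof of Theorem 3 is reduced to proving the remaining properties of (2.13), i.e. to a construction of
  the representation (1.7) with terms having the analytic extensions satisfying the bound (1.18)» · p. 269 [21] (`p0021.txt:L24–L27`)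
  with p. 268 «all terms in this representation satisfy the required properties, except possibly the last term (2.13)» ·
  `B12Sec2to5.Sec2Reduction`, `NewTermDelivered`, `smallFieldStep_of_sec2`, `B12StepObligation.sec2Reduction_holds` (the reduction
  sentence PROVED under the run dictionary `RunDict`: it is `Step.SFHyp.succ`), `Step.SFNewTerm` (= «the remaining properties of
  (2.13)», the per-step obligation delivered by §§3–5 + [II]), `Step.SFHyp.succ_iff`, `B13.SmallFieldStep`; cited only — at the
  level of this file's vocabulary the sentence is a theorem (`Step.SFHyp.succ`).
The four STATEMENT-LEVEL declarations whose locator falls in pp. 265–269 (`carve/CARVE-LIST.md` Block 20) are cited, not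
conjoined, for the stated reasons: `B12Prop2Claims260.Claim265Printed` (PROVED, `Claim265Printed_holds`),
`B12SmallFieldDomain259.chiFluctPrinted` ∕ `chiFluctPrintedAlt` (definitions with bodies of the function (2.9), not propositions),
`B12Eq213Body268.FluctData.onBondsPrinted` (a datum constructor, not a proposition).

HONEST SCOPE.  (a) `Hyp` is a HYPOTHESIS SCHEMA over the cell's carriers; inhabiting its carriers asserts nothing about Bałaban's
objects, and NOTHING of the computation (2.4)–(2.11) that PRODUCES (2.12) from (2.1) is reproduced — that computation is exactly the
content of the conjunct `Eq212Printed` (the rows B12.Eq2.4–2.11 hold its typed pieces).  (b) Positivity of the two fluctuation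
integrals (`𝐍″_k`, and the integral at `U_{k+1}`), implicit in print's taking logarithms, is NOT put into the bundle; the two
bookkeeping theorems that need it take it as the binders `hN`, `hne`, exactly as `B12Eq213Body268.form13_succ_of_action212_background`
does (`FluctData.integral_pos_iff`).  (c) (2.16) and (2.17)–(2.18) are typed as print's CONCLUSIONS for the two non-explicit
expressions of the new bracket of (1.3) — `log Z^{(k)}` and `Re 𝐄^{(k+1)}(g_k, ·)` — over ALL configurations of the carrier, the
convention of the tree's (1.19) `Step.SFNewTerm.gaugeInv119` and p. 263 `B12EuclClause263.EuclClause263`; the G^c-valued ∕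
analytically continued form (1.19) of the gauge clause is §3's (3.29) (`B12Inv329`), not §2's, and is not typed here.  (d) The
conjuncts are individually faithful; print's `𝐆` of (2.1) and of (2.2) is ONE object (`GF k = gaugeFixFn cd Finset.univ` in the
intended instance) — the bundle does not impose the identification, since the tree carries several typed `𝐆`'s
(`Setup.gaugeFixFn`, `B12RT013TwoLevel.gf017`).  (e) No `instance`, no `notation`, 0 sorry; imports `B12Eq213Body268`
(hence `Step`, `B12`, `B12Form13Step268`, `B12Eq21Body265`, `B12Eq019ActionBody`, `B12SmallFieldDomain259`), `B12EuclClause263` and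
`StepInhabited` only.  NOT a node discharge, NOT summit progress; nothing continuum, nothing about the mass gap.
-/

namespace Literature.MathematicalPhysics.QuantumFieldTheory.Balaban1983to89.B12Carve20Sect2FluctuationHyp

open Literature.MathematicalPhysics.QuantumFieldTheory.Balaban1983to89
open Step Step.SFTower B12Eq019ActionBody B12Eq21Body265 B12Eq213Body268 B12EuclClause263

noncomputable section

variable {P : Params} {G : Type*} [GaugeGroup G] {Φ 𝒢 : Type*}

/-! ## §1 The five printed sentences of pp. 265, 268, 269 with no declaration in the tree (hypothesis form) -/

/-- **p. 265 [PDF 17], after (2.1)** (text layer `p0017.txt:L14–L17`), verbatim: «We will define the characteristic function χ_k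
in such a way that the domain of integration in (2.1) is restricted to configurations V for which U_k(V) ∈ U_k(ε₀). Thus the
inductive assumption of the previous section is valid for the action A_k(U_k(V)).»  TYPED as the SUPPORT PROVISO of the density
`χ_k` (a function of `V` on `T^{(k)}`, as in (2.1)): wherever `χ_k(V) ≠ 0`, `V` lies in the domain of the background-field
assignment at level `k` (DICTIONARY of the module docstring: `bg.dom k` = «configurations V for which U_k(V) ∈ U_k(ε₀)»; the
concrete p. 259 refinement `B12SmallFieldDomain259.smallFieldDom bg ε₀ k` is a subset, `chiSupportPrinted_of_smallFieldDom`).  This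
is, by name, the binder `hχ` of the tree's `B12Eq019ActionBody.nextAction_eq_action21` ∕ `B12Eq21Body265.nextAction_eq_action21_of_form13`
(«(𝐓_kA_k)(W) = (2.1)» under the proviso) — no declaration stated it.  The construction of such a `χ_k` is (2.9) with the
regularity analysis of [15] (rows B12.Eq2.9, B12.Def@267), not asserted here. [cite: Balaban1987RG1, p.265 (after (2.1)) lines 14–17] -/
def ChiSupportPrinted {k : ℕ} {av : ∀ j, Averaging P j G} (bg : Background P G av) (χ : Density P k G) : Prop :=
  ∀ V : GaugeField P k G, χ V ≠ 0 → V ∈ bg.dom k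

/-- **p. 268 [PDF 20], (2.12)** (text layer `p0020.txt:L6–L15`), verbatim: «After these transformations we obtain the following
expression for the new action:
`A_{k+1}(U_{k+1}) = −(1/g_k²)A(U_{k+1}) + 𝐄_k(U_{k+1}) + [log Z^{(k)}(U_{k+1}) − log Z^{(k)}(1)] + log 𝐍″_k⁻¹ ∫dμ_{C^{(k)}}(B) χ_k
exp[Tr log(I − h((δ/δB)D̃)(g_kCB)) + log σ(g_kCB − hD̃(g_kCB)) + (1/g_k²)⟨H₁hD̃₃(g_kCB), J⟩ − (1/g_k²)G₃(g_kB) + (1/g_k²)⟨H₁g_kCB,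
Δ₁H₁hD̃(g_kCB)⟩ − (1/g_k²)⟨H₁hD̃(g_kCB), Δ₁H₁hD̃(g_kCB)⟩ − (1/g_k²)V(H₁(g_kCB − hD̃(g_kCB))) + {𝐄_k(U_k(exp i[g_kCB − hD̃(g_kCB)]V^{(k)}))
− 𝐄_k(U_k(V^{(k)}))}]. (2.12)»  TYPED as the EQUATION for the action of the step — `A (k+1)`, the `A_{k+1}` produced by (2.1) — read,
as print reads it, as a function of the new background field `U_{k+1} = U_{k+1}(W)` on the class of regular `W` of p. 265
(`W ∈ bg.dom (k+1)`, DICTIONARY): its value is the RIGHT MEMBER OF (2.12) WITH BODY, the tree's `B12Eq213Body268.action212 T k D`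
(first line `−(1/g_k²)A + 𝐄_k` with «𝐄_k = (1/g_k²)A + A_k» at `A_k` = the form (1.3) `Step.SFTower.action13 T k`, the bracket
`log Z^{(k)}`, and `log(𝐍″_k⁻¹ · ∫dμ_{C^{(k)}(U)} χ_k e^{𝐏^{(k)} + {…}})` over the fluctuation datum `D` of step `k`, whose two exponent
parts `𝐏^{(k)}`, `{…}` ARE the named pieces of the display).  In tree: the right member (`action212`), its substituted form
(`action212_eq`), the obligation `Step.SFStepObligation`, and this equation AS THE BINDER `h212` of
`B12Eq213Body268.form13_succ_of_action212_background` ∕ `form13_succ_of_nextAction_eq_action212` («print's equation (2.12), the §2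
computation, a HYPOTHESIS here»); no declaration stated the equation (SKELETON row B12.Eq2.13: «the EQUATION (2.12) for the
(0.19)-constructed A_{k+1} — the computation (2.2)–(2.11) — is NOT transported»).  Typed in exactly that binder shape.
[cite: Balaban1987RG1, (2.12) p.268] -/
def Eq212Printed {av : ∀ j, Averaging P j G} (bg : Background P G av) (A : ∀ j, Density P j G) (T : SFTower P G Φ 𝒢)
    (k : ℕ) (D : FluctData (GaugeField P 0 G)) : Prop :=
  ∀ W ∈ bg.dom (k + 1), A (k + 1) W = action212 T k D (bg.U (k + 1) W)

/-- **p. 268 [PDF 20], (2.13)** (text layer `p0020.txt:L16–L22`), verbatim: «Let us notice that the normalization constant 𝐍″_k is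
equal to the integral above at U_{k+1} = 1. The expression under the exponential is clearly a sum of two terms, one is connected
with the expansion of the action −(1/g_k²)A(U_k(V)) and the measure in (2.1), and we denote it by 𝐏^{(k)}(g_k, U_{k+1}, B), another
is the expression in the curly bracket {…}. The integral in (2.12) defines the new term 𝐄^{(k+1)} in the inductive definition of
the action A_{k+1} by the formula  𝐄^{(k+1)}(g_k, U_{k+1}) = log ∫dμ_{C^{(k)}}(B) χ_k exp[𝐏^{(k)}(g_k, U_{k+1}, B) + {…}]. (2.13)»
TYPED as the DEFINITIONAL IDENTIFICATION print makes: the `(k+1)`-st total term of the form (1.3) — the tower's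
`Re 𝐄^{(k+1)}(g_k, U) = (T.Etot (k+1) (T.flow.g k) (T.ofBackground U)).re` — IS the body (2.13) `B12Eq213Body268.FluctData.newTerm D
(T.flow.g k) U` at every new background field `U = U_{k+1}(W)`, `W ∈ bg.dom (k+1)`, and at `U ≡ 1` (where, by (2.14)
`FluctData.log_normConst`, it is `log 𝐍″_k`).  In tree: the body ((2.13) WITH BODY, `newTerm`; `normConst`; (2.14) by `rfl`) and
this identification AS THE BINDERS `hdef`, `hdef1` of `B12Eq213Body268.form13_succ_of_action212_background` («print's sentence
"The integral in (2.12) defines the new term …", hypothesis `hdef`»); no declaration stated it.  Typed in exactly that binder shape.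
[cite: Balaban1987RG1, (2.13) p.268] -/
def Def213Printed {av : ∀ j, Averaging P j G} (bg : Background P G av) (T : SFTower P G Φ 𝒢) (k : ℕ)
    (D : FluctData (GaugeField P 0 G)) : Prop :=
  (∀ W ∈ bg.dom (k + 1),
      (T.Etot (k + 1) (T.flow.g k) (T.ofBackground (bg.U (k + 1) W))).re = D.newTerm (T.flow.g k) (bg.U (k + 1) W)) ∧
    (T.Etot (k + 1) (T.flow.g k) (T.ofBackground 1)).re = D.newTerm (T.flow.g k) 1

/-- **p. 269 [PDF 21], (2.16)** (text layer `p0021.txt:L2–L9`), verbatim: «Let us discuss briefly the gauge invariance and the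
Euclidean invariance of this term. The gauge invariance was discussed already several times in the previous papers, so let us
recall only that all the expressions in (2.12), together with the measure, are invariant with respect to the gauge transformations
`U_{k+1} → Uᵘ_{k+1},  B′ → R(u)B′,  (R(u)B′)(b) = R(u(b₋))B′(b).  (2.16)`  The characteristic function is invariant with respect to
the transformations of the fluctuation field B′, because they are local, orthogonal transformations; therefore the expression
(2.13) is gauge invariant.»  TYPED as print's CONCLUSION for the two non-explicit expressions of the new bracket of (1.3) produced by
the step — «the expressions in (2.12)» `log Z^{(k)}(U_{k+1})` (`T.logZ k`) and «the expression (2.13)» `𝐄^{(k+1)}(g_k, U_{k+1})` (the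
tower's `Re 𝐄^{(k+1)}(g_k, ·)`): both are invariant under `U_{k+1} → Uᵘ_{k+1}` for every `G`-valued gauge transformation `u` of `T_η`
(`Setup.GaugeField.gaugeAct`), at every configuration of the carrier (the convention of the tree's (1.19) `Step.SFNewTerm.gaugeInv119`).
This is, by name, the binder `hZ` of `B12GaugeOrbits021.action13_gaugeAct` at `j = k` together with the real form at `j = k+1` of
`B12GaugeOrbits021.Etot_ofBackground_gaugeAct`'s conclusion; the MECHANISM (change of variables under the covariances of (2.16)) is
PROVED in the tree for the body (`B12Eq213Body268.FluctData.newTerm_eq_of_covariant`, `newTerm_gaussian_elim_eq_of_covariant`,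
`newTerm_onBondsPrinted_eq_of_covariant`, with the `χ_k` clause `B12ChiInvariance269.chiFluctPrinted_rotFluct`); the conclusion as a
clause on the tower had no declaration. [cite: Balaban1987RG1, (2.16) p.269] -/
def GaugeNewPrinted (T : SFTower P G Φ 𝒢) (k : ℕ) : Prop :=
  (∀ (u : GaugeTransf P 0 G) (U : GaugeField P 0 G), T.logZ k (GaugeField.gaugeAct u U) = T.logZ k U) ∧
    ∀ (u : GaugeTransf P 0 G) (U : GaugeField P 0 G),
      (T.Etot (k + 1) (T.flow.g k) (T.ofBackground (GaugeField.gaugeAct u U))).re =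
        (T.Etot (k + 1) (T.flow.g k) (T.ofBackground U)).re

/-- **p. 269 [PDF 21], (2.17)–(2.18)** (text layer `p0021.txt:L9–L23`), verbatim: «Now consider a Euclidean symmetry r of the torus
T, preserving the torus T^{(k+1)}. We define generally  (rU)(b) = U(rb),  rb = r⟨b₋, b₊⟩ = ⟨rb₋, rb₊⟩. (2.17)  By their definitions
the expressions in (2.1) are invariant with respect to these transformations. If we split the field V = V′V^{(k)}, and V^{(k)},
U_{k+1} transform as above, then the expressions are still invariant assuming that V′ transforms as follows:  (rV′)(b) = V′(rb) if
rb is positively oriented,  (rV′)(b) = R(V^{(k)}(rb))V′⁻¹(−(rb)) if rb is negatively oriented. (2.18)  … The above definition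
secures the identity r(V′V^{(k)}) = (rV′)(rV^{(k)}), hence the invariance also. The transformation (2.18) generates an orthogonal
transformation of the fluctuation field B′, hence all the remaining operations preserve the invariance for the same reasons as for
the gauge invariance. Thus the effective action is invariant with respect to the Euclidean transformations (2.17) of the background
field.»  TYPED as print's CONCLUSION AT THE NEW INDEX in the tree's reading of «Euclidean symmetry r of the torus T, preserving the
torus T^{(k+1)}» (`B12EuclClause263.NestedInvariant (k+1)`: the translations by `L^{k+1}·a`, the centre reflections and the
coordinate permutations of `T_η`, acting by (2.17)): the two non-explicit expressions of the new bracket of (1.3) — `log Z^{(k)}` and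
`Re 𝐄^{(k+1)}(g_k, ·)` — are invariant (the explicit ones, `A(U)`, are: `B12EuclClause263.wilsonAction4_nestedInvariant`).  This is
EXACTLY the `j = k` component of the p. 263 clause `B12EuclClause263.EuclClause263 T (k+1)` (the inductive assumption print
re-establishes here for the new term): `euclClause263_succ_iff` below; with it the printed sentence for `A_{k+1}` follows by the
tree's `B12EuclClause263.action13_nestedInvariant` (`Hyp.nestedInvariant_action13_succ`).  THEOREMS OF RECORD for the mechanism:
`B12EuclTransf218.reflect_prodCfg` («r(V′V^{(k)}) = (rV′)(rV^{(k)})»), `lin218_orthogonal` («generates an orthogonal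
transformation»), `B12ChiInvariance269.chiFluctPrinted_clin218` ∕ `_translate` ∕ `_cbond`, `B12EuclClause263.chiFluctPrinted_permute`;
the conclusion as a clause on the tower had no declaration. [cite: Balaban1987RG1, (2.17)–(2.18) p.269] -/
def EuclNewPrinted (T : SFTower P G Φ 𝒢) (k : ℕ) : Prop :=
  NestedInvariant (k + 1) (T.logZ k) ∧
    NestedInvariant (k + 1) (fun U : GaugeField P 0 G => (T.Etot (k + 1) (T.flow.g k) (T.ofBackground U)).re)

/-! ## §2 The bundle keyed to `stmt-QuantumFields-20543` -/

section Bundle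

/-- **BLOCK 20 OF [B12] (Sect. 2, pp. 265–269) AS ONE HYPOTHESIS — the step `k → k+1` as printed**, keyed to
`stmt-QuantumFields-20543` (also feeds `stmt-QuantumFields-20541`): the conjunction, BY NAME, of the section's printed statements in
the cell's typed forms, for the families `Tk`, `χ`, `GF`, `A` of transformations (at OPERATOR LEVEL `Tk j : Density_j → Density_{j+1}`,
the form (0.19) uses — `Setup.SmallFieldStepOp`; the carrier `RTOp` of `Step.GeneratedBySmallFieldRT` is vacuous for infinite compact
`G`, `Setup` v1.3 VACUITY FLAG, so the bundle binds the operator and §4 serves `RTOpI` ∕ `RTOp` consumers through the tree's bridges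
of module `StepInhabited`),
characteristic functions, gauge-fixing functions and actions, the background record `bg`, the tower `T` of the form (1.3), and the
step-`k` data `cd`, `reg`, `D` (DICTIONARY of the module docstring) —
(1) (2.1) p. 265 «we apply the next renormalization transformation 𝐓_k restricted to a small field region by a characteristic
function χ_k»: `A_{k+1} = 𝐓_kA_k` in the small-field form (0.19)/(2.1), `Setup.SmallFieldStepOp`;
(2) p. 265 the support proviso of `χ_k`, `ChiSupportPrinted`;
(3) (2.2)–(2.3) p. 265 the critical configuration `V^{(k)} = M^k(U_{k+1}(W))`, for every regular `W`,
`B12SmallFieldDomain259.CriticalPoint23`;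
(4) (2.12) p. 268 the expression for the new action, `Eq212Printed`;
(5) (2.13) p. 268 the definition of the new term `𝐄^{(k+1)}` (with `𝐍″_k`, (2.14)), `Def213Printed`;
(6) p. 268 «Let us remark that the expression under the exponential above vanishes at g_k = 0» (over the datum: the exponent
`𝐏^{(k)} + {…}` at coupling `0` vanishes identically; tree: `B12ZeroCoupling268.p268_vanishes_at_zero_coupling` for the schematic
letters, `FluctData.newTerm_of_exponent_zero`);
(7) (2.15) p. 268 «Finally we perform the coupling constant renormalization 1/g_k² = 1/g²_{k+1} + β_{k+1}(g_k) (2.15) with the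
β-function defined by the formulas (1.20), (1.22) for j = k» (tree: `Setup.Flow.SatisfiesRG`, `Step.SFNewTerm.rg`);
(8) (2.16) p. 269 gauge invariance of the new bracket, `GaugeNewPrinted`;
(9) (2.17)–(2.18) p. 269 Euclidean invariance of the new bracket, `EuclNewPrinted`.
A node prover takes `(h : Hyp …)`; the displays (2.4)–(2.11) (the computation producing (2.12)) and the reduction sentence of
p. 269 are PROVED ∕ carried with bodies in the tree (INDEX in the module docstring) and are therefore not hypotheses — the
computation AS A WHOLE is conjunct (4). [cite: Balaban1987RG1, Sect. 2 (2.1)–(2.18) pp.265–269] -/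
def Hyp (av : ∀ j, Averaging P j G) (Tk : ∀ j, Density P j G → Density P (j + 1) G) (χ GF : ∀ j, Density P j G)
    (bg : Background P G av) (A : ∀ j, Density P j G) (T : SFTower P G Φ 𝒢) (k : ℕ) (cd : ContourData P k G)
    (reg : Set (GaugeField P k G)) (D : FluctData (GaugeField P 0 G)) : Prop :=
  SmallFieldStepOp (Tk k) (χ k) (GF k) (T.flow.g k) (A k) (A (k + 1)) ∧
  ChiSupportPrinted bg (χ k) ∧
  (∀ W ∈ bg.dom (k + 1), B12SmallFieldDomain259.CriticalPoint23 av bg k cd reg W) ∧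
  Eq212Printed bg A T k D ∧
  Def213Printed bg T k D ∧
  (∀ (U : GaugeField P 0 G) (B : D.𝓑), D.exponent 0 U B = 0) ∧
  1 / (T.flow.g k) ^ 2 = 1 / (T.flow.g (k + 1)) ^ 2 + T.flow.β (k + 1) (T.flow.g k) ∧
  GaugeNewPrinted T k ∧
  EuclNewPrinted T k

end Bundle

/-! ## §3 How the bundle delivers the section's printed consequences (pointers; the theorems are the tree's, nothing new)

With `h : Hyp av Tk χ GF bg A T k cd reg D` and its conjuncts numbered (1)–(9) as in the docstring of `Hyp`
(`obtain ⟨h21, hχ, h23, h212, h213, h0, h215, h216, h217⟩ := h`):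
* p. 268 «The equalities (2.12), (2.14) together with the definitions (2.13), (2.15) imply that the action A_{k+1} is given by (1.3)
  with k+1 instead of k»: (4) + (5) + (7) ⇒ `A (k+1) W = Step.SFTower.action13 T (k+1) (bg.U (k+1) W)` on `bg.dom (k+1)` by
  `B12Eq213Body268.form13_succ_of_action212_background` (given the non-vanishing of the two integrals, print's taking of logarithms) —
  `Hyp.form13_succ`; hence, with (1) and (7), the record `Step.GeneratedBySmallFieldRT av Tk χ GF bg A T k` of the first `k` steps
  extends to `k+1` — `Hyp.generated_succ` (fields `step`, `form13`, `rg` at the new index);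
* p. 265 «Thus the inductive assumption of the previous section is valid for the action A_k(U_k(V))» + (2.1): (1) + (2) + the form
  (1.3) at `k` ⇒ `A (k+1) = B12Eq019ActionBody.action21 (Tk k).T (χ k) (GF k) (g_k) (U_k) A 𝐄_k` with `𝐄_k = (1/g_k²)A + A_k`
  (`B12Eq21Body265.EkOf`), by `eq_nextAction_of_smallFieldStep` and `nextAction_eq_action21_of_form13` — `Hyp.nextAction_eq_action21`;
* p. 269 «therefore the expression (2.13) is gauge invariant» ⇒ with the inductive gauge invariance of `A_k` in the form (1.3)
  (p. 263; tree `B12GaugeOrbits021.gaugeInvariant_action13`): (7) + (8) ⇒ `GaugeField.GaugeInvariant (Step.SFTower.action13 T (k+1))`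
  — `Hyp.gaugeInvariant_action13_succ`;
* p. 269 «Thus the effective action is invariant with respect to the Euclidean transformations (2.17) of the background field»:
  (9) is the new component of the p. 263 clause (`euclClause263_succ_iff`), so with the clause at `k` the tree's
  `B12EuclClause263.action13_nestedInvariant` gives `NestedInvariant (k+1) (Step.SFTower.action13 T (k+1))` —
  `Hyp.nestedInvariant_action13_succ`;
* p. 269 «Thus the proof of Theorem 3 is reduced to proving the remaining properties of (2.13)»: at the level of this vocabulary the
  reduction is the tree's `Step.SFHyp.succ` ∕ `B12StepObligation.sec2Reduction_holds`; the «remaining properties» are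
  `Step.SFNewTerm T c k` minus its field `rg`, which is conjunct (7) (`sfNewTerm_of_rg_and_clauses`, `Hyp.sfNewTerm_of_clauses`). -/

/-! ## §4 The §3 recipes, kernel-checked: bookkeeping theorems over the bundle (nothing printed is proved here) -/

section Delivery

variable {av : ∀ j, Averaging P j G} {Tk : ∀ j, Density P j G → Density P (j + 1) G} {χ GF : ∀ j, Density P j G}
  {bg : Background P G av} {A : ∀ j, Density P j G} {T : SFTower P G Φ 𝒢} {k : ℕ} {cd : ContourData P k G}
  {reg : Set (GaugeField P k G)} {D : FluctData (GaugeField P 0 G)}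

/-- The bundle IS the nine-fold conjunction (1)–(9) of its docstring, definitionally (unfolding lemma, no content beyond `Hyp`).
[cite: Balaban1987RG1, Sect. 2 (2.1)–(2.18) pp.265–269] -/
theorem hyp_iff :
    Hyp av Tk χ GF bg A T k cd reg D ↔
      SmallFieldStepOp (Tk k) (χ k) (GF k) (T.flow.g k) (A k) (A (k + 1)) ∧
      ChiSupportPrinted bg (χ k) ∧
      (∀ W ∈ bg.dom (k + 1), B12SmallFieldDomain259.CriticalPoint23 av bg k cd reg W) ∧
      Eq212Printed bg A T k D ∧
      Def213Printed bg T k D ∧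
      (∀ (U : GaugeField P 0 G) (B : D.𝓑), D.exponent 0 U B = 0) ∧
      1 / (T.flow.g k) ^ 2 = 1 / (T.flow.g (k + 1)) ^ 2 + T.flow.β (k + 1) (T.flow.g k) ∧
      GaugeNewPrinted T k ∧
      EuclNewPrinted T k :=
  Iff.rfl

/-- Conjunct (1): (2.1) p. 265 [PDF 17], `A_{k+1} = 𝐓_kA_k` in the small-field form (operator level), `Setup.SmallFieldStepOp`.
[cite: Balaban1987RG1, (2.1) p.265] -/
theorem Hyp.step21 (h : Hyp av Tk χ GF bg A T k cd reg D) :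
    SmallFieldStepOp (Tk k) (χ k) (GF k) (T.flow.g k) (A k) (A (k + 1)) :=
  h.1

/-- Conjunct (2): the support proviso of `χ_k`, p. 265 [PDF 17], `ChiSupportPrinted`. [cite: Balaban1987RG1, p.265 (after (2.1))] -/
theorem Hyp.chiSupport (h : Hyp av Tk χ GF bg A T k cd reg D) : ChiSupportPrinted bg (χ k) :=
  h.2.1

/-- Conjunct (3): (2.2)–(2.3) p. 265 [PDF 17] for every regular `W`, `B12SmallFieldDomain259.CriticalPoint23`.
[cite: Balaban1987RG1, (2.2)–(2.3) p.265] -/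
theorem Hyp.critical23 (h : Hyp av Tk χ GF bg A T k cd reg D) {W : GaugeField P (k + 1) G} (hW : W ∈ bg.dom (k + 1)) :
    B12SmallFieldDomain259.CriticalPoint23 av bg k cd reg W :=
  h.2.2.1 W hW

/-- Conjunct (4): (2.12) p. 268 [PDF 20], `Eq212Printed`. [cite: Balaban1987RG1, (2.12) p.268] -/
theorem Hyp.eq212 (h : Hyp av Tk χ GF bg A T k cd reg D) : Eq212Printed bg A T k D :=
  h.2.2.2.1

/-- Conjunct (5): (2.13) p. 268 [PDF 20], `Def213Printed`. [cite: Balaban1987RG1, (2.13) p.268] -/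
theorem Hyp.def213 (h : Hyp av Tk χ GF bg A T k cd reg D) : Def213Printed bg T k D :=
  h.2.2.2.2.1

/-- Conjunct (6): p. 268 [PDF 20] «the expression under the exponential above vanishes at g_k = 0», over the datum.
[cite: Balaban1987RG1, (2.13)–(2.14) p.268] -/
theorem Hyp.exponent_zero (h : Hyp av Tk χ GF bg A T k cd reg D) (U : GaugeField P 0 G) (B : D.𝓑) :
    D.exponent 0 U B = 0 :=
  h.2.2.2.2.2.1 U B

/-- Conjunct (7): (2.15) p. 268 [PDF 20], the coupling constant renormalization defining `g_{k+1}`. [cite: Balaban1987RG1, (2.15) p.268] -/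
theorem Hyp.rg215 (h : Hyp av Tk χ GF bg A T k cd reg D) :
    1 / (T.flow.g k) ^ 2 = 1 / (T.flow.g (k + 1)) ^ 2 + T.flow.β (k + 1) (T.flow.g k) :=
  h.2.2.2.2.2.2.1

/-- Conjunct (8): (2.16) p. 269 [PDF 21], `GaugeNewPrinted`. [cite: Balaban1987RG1, (2.16) p.269] -/
theorem Hyp.gauge216 (h : Hyp av Tk χ GF bg A T k cd reg D) : GaugeNewPrinted T k :=
  h.2.2.2.2.2.2.2.1

/-- Conjunct (9): (2.17)–(2.18) p. 269 [PDF 21], `EuclNewPrinted`. [cite: Balaban1987RG1, (2.17)–(2.18) p.269] -/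
theorem Hyp.eucl217 (h : Hyp av Tk χ GF bg A T k cd reg D) : EuclNewPrinted T k :=
  h.2.2.2.2.2.2.2.2

/-- The support proviso implies the abstract binder shape `hχ` of `B12Eq019ActionBody.nextAction_eq_action21` for any domain
containing `bg.dom k` (trivial; recorded so that the name travels). [cite: Balaban1987RG1, p.265 (after (2.1))] -/
theorem ChiSupportPrinted.mono {χk : Density P k G} (h : ChiSupportPrinted bg χk) {dom : Set (GaugeField P k G)}
    (hdom : bg.dom k ⊆ dom) : ∀ V, χk V ≠ 0 → V ∈ dom :=
  fun V hV => hdom (h V hV)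

/-- A characteristic function supported in the CONCRETE small-field domain of p. 259 (`B12SmallFieldDomain259.smallFieldDom bg ε₀ k`:
`V ∈ bg.dom k` with `|∂U_k(V) − 1| < ε₀η²` on `T_η`) satisfies the proviso as typed. [cite: Balaban1987RG1, Thm 1 p.259, p.265] -/
theorem chiSupportPrinted_of_smallFieldDom {χk : Density P k G} (ε₀ : ℝ)
    (h : ∀ V, χk V ≠ 0 → V ∈ B12SmallFieldDomain259.smallFieldDom bg ε₀ k) : ChiSupportPrinted bg χk :=
  fun V hV => ((B12SmallFieldDomain259.mem_smallFieldDom bg ε₀ k V).mp (h V hV)).1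

/-- **(2.1) WITH BODY, over the bundle** (p. 265 [PDF 17]: «we apply the next renormalization transformation 𝐓_k restricted to a
small field region by a characteristic function χ_k … The meaning of the function 𝐄_k is obvious, it is equal to (1/g_k²)A + A_k …
Thus the inductive assumption of the previous section is valid for the action A_k(U_k(V))»): conjuncts (1) + (2) and the form
(1.3) of `A_k` on `bg.dom k` (the inductive assumption; the field `form13` of `Step.GeneratedBySmallFieldRT` at `k`) give
`A_{k+1} = (2.1)` with `𝐄_k := (1/g_k²)A + A_k^{(1.3)}` — the tree's `B12Eq019ActionBody.eq_nextAction_of_smallFieldStep` and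
`B12Eq21Body265.nextAction_eq_action21_of_form13`. [cite: Balaban1987RG1, (2.1) p.265] -/
theorem Hyp.nextAction_eq_action21 (h : Hyp av Tk χ GF bg A T k cd reg D)
    (hform : ∀ V ∈ bg.dom k, A k V = T.action13 k (bg.U k V)) :
    A (k + 1) = action21 (Tk k) (χ k) (GF k) (T.flow.g k) (bg.U k) wilsonAction4
      (EkOf (T.flow.g k) wilsonAction4 (T.action13 k)) := by
  rw [eq_nextAction_of_smallFieldStepOp h.step21]
  exact nextAction_eq_action21_of_form13 T bg A k hform (Tk k) (GF k) h.chiSupport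

/-- **p. 268 [PDF 20], over the bundle** («The equalities (2.12), (2.14) together with the definitions (2.13), (2.15) imply that the
action A_{k+1} is given by (1.3) with k+1 instead of k»): conjuncts (4) (2.12), (5) (2.13)/(2.14) and (7) (2.15) give, on the class of
regular `W`, `A_{k+1}(W) = A_{k+1}^{(1.3)}(U_{k+1}(W))` — the field `form13` of `Step.GeneratedBySmallFieldRT` at the index `k+1` —
by the tree's `B12Eq213Body268.form13_succ_of_action212_background`, GIVEN the non-vanishing of `𝐍″_k` and of the fluctuation integral
at `U_{k+1}(W)` (`hN`, `hne`: print takes their logarithms; HONEST SCOPE (b)). [cite: Balaban1987RG1, (2.12)–(2.15) p.268] -/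
theorem Hyp.form13_succ (h : Hyp av Tk χ GF bg A T k cd reg D) (hN : D.normConst (T.flow.g k) ≠ 0)
    (hne : ∀ W ∈ bg.dom (k + 1), D.integral (T.flow.g k) (bg.U (k + 1) W) ≠ 0) :
    ∀ W ∈ bg.dom (k + 1), A (k + 1) W = T.action13 (k + 1) (bg.U (k + 1) W) :=
  form13_succ_of_action212_background T bg A k D h.rg215 h.def213.1 h.def213.2 hN hne h.eq212

/-- **THE STEP EXTENDS THE GENERATED SEQUENCE BY ONE** (Theorem 3 p. 264: «the sequence of actions A_k, defined inductively by
the small field renormalization transformations (0.17)–(0.20)»; tree, operator level: `Step.GeneratedBySmallFieldOp Tk χ GF bg A T K`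
(module `StepInhabited`) = the first `K` steps (0.19) with the form (1.3) at every `k ≤ K` and (0.20) up to `K`): if the first `k` steps are of
record and Sect. 2 is performed at the step `k` (the bundle, with the non-vanishing of the two integrals), then the first `k+1` steps
are of record — `step` at `k` is conjunct (1), `form13` at `k+1` is `Hyp.form13_succ`, `rg` at `k` is conjunct (7).  Kernel-checked
bookkeeping. [cite: Balaban1987RG1, (2.1) p.265, (2.12)–(2.15) p.268, Thm 3 p.264] -/
theorem Hyp.generated_succ (h : Hyp av Tk χ GF bg A T k cd reg D) (hgen : GeneratedBySmallFieldOp Tk χ GF bg A T k)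
    (hN : D.normConst (T.flow.g k) ≠ 0) (hne : ∀ W ∈ bg.dom (k + 1), D.integral (T.flow.g k) (bg.U (k + 1) W) ≠ 0) :
    GeneratedBySmallFieldOp Tk χ GF bg A T (k + 1) where
  step j hj := by
    rcases Nat.lt_succ_iff_lt_or_eq.mp hj with hj' | rfl
    · exact hgen.step j hj'
    · exact h.step21
  form13 j hj := by
    rcases Nat.of_le_succ hj with hj' | rfl
    · exact hgen.form13 j hj'
    · exact h.form13_succ hN hne
  rg j hj := by
    rcases Nat.lt_succ_iff_lt_or_eq.mp hj with hj' | rfl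
    · exact hgen.rg j hj'
    · exact h.rg215

section Carriers

variable [MeasurableSpace G] [HaarData G]

/-- The same over the INHABITED carrier `RTOpI` of the renormalization transformations (`Setup` v1.3; the bundle taken at the
operators `j ↦ (TkI j).T`): `Step.GeneratedBySmallFieldRTI` (module `StepInhabited`) advances by one step — through the tree's
definitional bridge `Step.generatedBySmallFieldRTI_iff_op`. [cite: Balaban1987RG1, (2.1) p.265, (2.12)–(2.15) p.268] -/
theorem Hyp.generatedRTI_succ {TkI : ∀ j, RTOpI P j G (av j)}
    (h : Hyp av (fun j => (TkI j).T) χ GF bg A T k cd reg D) (hgen : GeneratedBySmallFieldRTI TkI χ GF bg A T k)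
    (hN : D.normConst (T.flow.g k) ≠ 0) (hne : ∀ W ∈ bg.dom (k + 1), D.integral (T.flow.g k) (bg.U (k + 1) W) ≠ 0) :
    GeneratedBySmallFieldRTI TkI χ GF bg A T (k + 1) :=
  (generatedBySmallFieldRTI_iff_op TkI χ GF bg A T (k + 1)).mpr
    (h.generated_succ ((generatedBySmallFieldRTI_iff_op TkI χ GF bg A T k).mp hgen) hN hne)

/-- The same for the record OF RECORD `Step.GeneratedBySmallFieldRT` over the carrier `RTOp` (the binder family of
`Step.B12Thm3Shape` ∕ `Step.SFStepObligation`; vacuous for infinite compact `G` by the `Setup` v1.3 flag, kept for the consumers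
of record) — through `Step.generatedBySmallFieldRT_iff_op` (module `StepInhabited`). [cite: Balaban1987RG1, (2.1) p.265, (2.12)–(2.15) p.268] -/
theorem Hyp.generatedRT_succ {TkR : ∀ j, RTOp P j G (av j)}
    (h : Hyp av (fun j => (TkR j).T) χ GF bg A T k cd reg D) (hgen : GeneratedBySmallFieldRT av TkR χ GF bg A T k)
    (hN : D.normConst (T.flow.g k) ≠ 0) (hne : ∀ W ∈ bg.dom (k + 1), D.integral (T.flow.g k) (bg.U (k + 1) W) ≠ 0) :
    GeneratedBySmallFieldRT av TkR χ GF bg A T (k + 1) :=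
  (generatedBySmallFieldRT_iff_op av TkR χ GF bg A T (k + 1)).mpr
    (h.generated_succ ((generatedBySmallFieldRT_iff_op av TkR χ GF bg A T k).mp hgen) hN hne)

end Carriers

/-- **The p. 263 clause advances by exactly the new component** (as `Step.SFHyp.succ_iff` for the bounds): the Euclidean clause
for the action `A_{k+1}` in the form (1.3) — `B12EuclClause263.EuclClause263 T (k+1)`, all `j ≤ k` — is the clause for `A_k`
together with `EuclNewPrinted T k`.  Kernel-checked bookkeeping. [cite: Balaban1987RG1, §1 p.263, (2.17) p.269] -/
theorem euclClause263_succ_iff (T : SFTower P G Φ 𝒢) (k : ℕ) :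
    EuclClause263 T (k + 1) ↔ EuclClause263 T k ∧ EuclNewPrinted T k := by
  constructor
  · intro h
    exact ⟨fun j hj => h j (Nat.lt_succ_of_lt hj), h k (Nat.lt_succ_self k)⟩
  · rintro ⟨hold, hnew⟩ j hj
    rcases Nat.lt_succ_iff_lt_or_eq.mp hj with hj' | rfl
    · exact hold j hj'
    · exact hnew

/-- **p. 269 [PDF 21], over the bundle** («Thus the effective action is invariant with respect to the Euclidean transformations
(2.17) of the background field»): conjunct (9) and the p. 263 clause for `A_k` (the inductive assumption, `EuclClause263 T k`)
give the invariance of `A_{k+1}` in the form (1.3) under the Euclidean transformations of `T_η` preserving `T^{(k+1)}`, by the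
tree's `B12EuclClause263.action13_nestedInvariant`. [cite: Balaban1987RG1, (2.17)–(2.18) p.269] -/
theorem Hyp.nestedInvariant_action13_succ (h : Hyp av Tk χ GF bg A T k cd reg D) (hold : EuclClause263 T k) :
    NestedInvariant (k + 1) (T.action13 (k + 1)) :=
  action13_nestedInvariant T ((euclClause263_succ_iff T k).mpr ⟨hold, h.eucl217⟩)

/-- The new bracket of (1.3) — `[log Z^{(k)}(U) − log Z^{(k)}(1)] + [Re 𝐄^{(k+1)}(g_k, U) − Re 𝐄^{(k+1)}(g_k, 1)]` — is a gauge
invariant function of `U` under `GaugeNewPrinted` (the vacuum subtractions are constants). [cite: Balaban1987RG1, (2.16) p.269] -/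
theorem GaugeNewPrinted.newBracket_gaugeAct {T : SFTower P G Φ 𝒢} {k : ℕ} (h : GaugeNewPrinted T k)
    (u : GaugeTransf P 0 G) (U : GaugeField P 0 G) :
    (T.logZ k (GaugeField.gaugeAct u U) - T.logZ k 1)
        + ((T.Etot (k + 1) (T.flow.g k) (T.ofBackground (GaugeField.gaugeAct u U))).re
            - (T.Etot (k + 1) (T.flow.g k) (T.ofBackground 1)).re)
      = (T.logZ k U - T.logZ k 1)
        + ((T.Etot (k + 1) (T.flow.g k) (T.ofBackground U)).re - (T.Etot (k + 1) (T.flow.g k) (T.ofBackground 1)).re) := by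
  rw [h.1 u U, h.2 u U]

/-- **p. 269 [PDF 21], over the bundle** («therefore the expression (2.13) is gauge invariant»; «all the expressions in (2.12) …
are invariant»): conjuncts (7) (2.15) and (8) (2.16) and the gauge invariance of `A_k` in the form (1.3) (the inductive statement
of p. 263 «the action A_k(U) … is gauge invariant»; tree `B12GaugeOrbits021.gaugeInvariant_action13`) give the gauge invariance of
`A_{k+1}` in the form (1.3), through `B12Form13Step268.action13_succ`. [cite: Balaban1987RG1, (2.16) p.269] -/
theorem Hyp.gaugeInvariant_action13_succ (h : Hyp av Tk χ GF bg A T k cd reg D)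
    (hold : GaugeField.GaugeInvariant (T.action13 k)) : GaugeField.GaugeInvariant (T.action13 (k + 1)) := by
  intro u U
  rw [B12Form13Step268.action13_succ T k _ h.rg215, B12Form13Step268.action13_succ T k U h.rg215, hold u U,
    h.gauge216.newBracket_gaugeAct u U]

/-- **«the remaining properties of (2.13)»** (p. 269 [PDF 21]) in the tree's per-step obligation form: `Step.SFNewTerm T c k` is
conjunct (7) (its field `rg`, (2.15)) together with the six clauses (1.7), (1.18), (1.19) (term and space), and p. 264 (β smooth,
bounded) at the new index — which are what §§3–5 and [II] deliver (`B12StepObligation.sfNewTerm_of_deliverables`), NOT statements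
of Sect. 2.  Kernel-checked repackaging, so that a consumer holding the bundle and those six clauses has the obligation.
[cite: Balaban1987RG1, (2.13)–(2.15) p.268, p.269] -/
theorem sfNewTerm_of_rg_and_clauses {T : SFTower P G Φ 𝒢} {c : SFConsts} {k : ℕ}
    (hrg : 1 / (T.flow.g k) ^ 2 = 1 / (T.flow.g (k + 1)) ^ 2 + T.flow.β (k + 1) (T.flow.g k))
    (hloc : ∀ X g φ ψ, T.agreeOn (k + 1) X φ ψ → T.E (k + 1) X g φ = T.E (k + 1) X g ψ)
    (h118 : ∀ X g φ, 0 ≤ g → g ≤ c.γ → φ ∈ T.space (k + 1) X c.α₀ c.α₁ →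
      ‖T.E (k + 1) X g φ‖ ≤ c.E₀ * Real.exp (-c.κ * (T.sys (k + 1)).dj X))
    (hsp : ∀ X u φ, φ ∈ T.space (k + 1) X c.α₀ c.α₁ → T.act u φ ∈ T.space (k + 1) X c.α₀ c.α₁)
    (h119 : ∀ X g u φ, T.E (k + 1) X g (T.act u φ) = T.E (k + 1) X g φ)
    (hsm : ∀ n : ℕ, ContDiffOn ℝ n (T.flow.β (k + 1)) (Set.Icc 0 c.γ))
    (hbd : ∀ x ∈ Set.Icc (0:ℝ) c.γ, |T.flow.β (k + 1) x| ≤ c.β') : SFNewTerm T c k :=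
  ⟨hrg, hloc, h118, hsp, h119, hsm, hbd⟩

/-- The bundle supplies the `rg` field of the obligation: with the six delivered clauses, `Step.SFNewTerm T c k`.
[cite: Balaban1987RG1, (2.15) p.268] -/
theorem Hyp.sfNewTerm_of_clauses (h : Hyp av Tk χ GF bg A T k cd reg D) {c : SFConsts}
    (hloc : ∀ X g φ ψ, T.agreeOn (k + 1) X φ ψ → T.E (k + 1) X g φ = T.E (k + 1) X g ψ)
    (h118 : ∀ X g φ, 0 ≤ g → g ≤ c.γ → φ ∈ T.space (k + 1) X c.α₀ c.α₁ →
      ‖T.E (k + 1) X g φ‖ ≤ c.E₀ * Real.exp (-c.κ * (T.sys (k + 1)).dj X))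
    (hsp : ∀ X u φ, φ ∈ T.space (k + 1) X c.α₀ c.α₁ → T.act u φ ∈ T.space (k + 1) X c.α₀ c.α₁)
    (h119 : ∀ X g u φ, T.E (k + 1) X g (T.act u φ) = T.E (k + 1) X g φ)
    (hsm : ∀ n : ℕ, ContDiffOn ℝ n (T.flow.β (k + 1)) (Set.Icc 0 c.γ))
    (hbd : ∀ x ∈ Set.Icc (0:ℝ) c.γ, |T.flow.β (k + 1) x| ≤ c.β') : SFNewTerm T c k :=
  sfNewTerm_of_rg_and_clauses h.rg215 hloc h118 hsp h119 hsm hbd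

/-- **The new term at zero coupling, over the bundle** (p. 268 «vanishes at g_k = 0»): conjunct (6) gives
`𝐄^{(k+1)}(0, U) = log ∫ χ_k dμ_{C^{(k)}(U)}` for the body (2.13), by the tree's `FluctData.newTerm_of_exponent_zero`.
[cite: Balaban1987RG1, (2.13)–(2.14) p.268] -/
theorem Hyp.newTerm_zero (h : Hyp av Tk χ GF bg A T k cd reg D) (U : GaugeField P 0 G) :
    D.newTerm 0 U = Real.log (∫ B, D.χ U B ∂(D.μ U)) :=
  D.newTerm_of_exponent_zero (h.exponent_zero U)

end Delivery

end

end Literature.MathematicalPhysics.QuantumFieldTheory.Balaban1983to89.B12Carve20Sect2FluctuationHyp
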